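import Literature.Computability.Cryptography.LiuPassLemma53Defs
import Literature.Computability.Cryptography.LeftoverHashJoint
import Literature.Computability.Complexity.CircuitLowerBounds
import HarnessLib

/-!
# Liu–Pass Lemma 5.3: density of `f'_{r(n)}` (the output is `3/n^{α'/2}`-close to uniform)

Fourth level of the decomposition of `condEPPRG_of_OWFExist` (Liu–Pass, FOCS 2020, Thm 5.5):
the **density** clause of Lemma 5.3 for the construction `L53Params.F` of
`LiuPassLemma53Defs.lean` — for a regular `f` (fibres in `{0,1}ⁿ` of size `≤ 2^{r(n)}`) on dense
sets `S_n` (`2ⁿ ≤ n·|S_n|`),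

  `Δ(f'_{r(n)}(x ‖ τ), U_ℓ) ≤ 3 / n^{α'/2}`   (`x ← S_n`, `τ ← U_{3n^c}`, all large `n`; `eventually_density`, and the same bound for the ideal
  Goldreich–Levin sample `g(x‖ρ) ‖ σ ‖ u`, `eventually_density_ideal`),

stated exactly as in the named fact `liuPass_lemma53` (`PMF.tvDist` of
`(condUniform (lpSeeds S c n)).map (F (r n))` to `uniformBits (lpLen53 c α' n)`).

Printed proof (arXiv:2009.11514, Appendix): two applications of the Leftover Hash Lemma (`REAL`,
`HYB₁`, `HYB₂`). Here: one application of the **sharp joint** Leftover Hash Lemma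
(`LeftoverHash.leftoverHash_joint_sharp_of_fibre_le`, `LeftoverHashJoint.lean`) to the doubly keyed
map `((R₁, R₂), x) ↦ ((R₁, R₂), h¹_{R₁}(x), h²_{R₂}(pad (f x)))`, after

* re-indexing the seeds `x ‖ R₁ ‖ R₂ ‖ junk ‖ σ` as `((R₁, R₂), x, (junk, σ))` (`seedMap`, injective,
  onto `lpSeeds`: `image_seedMap`);
* recoding the output `R₁ ‖ R₂ ‖ junk ‖ h¹ ‖ h² ‖ σ` injectively from `(((R₁,R₂),(h¹,h²)), (junk, σ))`
  (`outMap`, `GG_seedMap`, for the core `GG` with an arbitrary pass-through suffix), whose image of the full cube is the set of all strings of the output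
  length (`image_outMap`);
* dropping the pass-through coordinates `(junk, σ)` (`LeftoverHash.distUnif_prod_right`) and the
  output recoding (`LeftoverHash.distUnif_comp_of_injective`);
* the bridge `sdUnif = distUnif` for maps into strings of one length (`sdUnif_eq_distUnif`) and
  `tvDist = sdUnif` (`tvDist_condUniform_map_eq_sdUnif`, `LiuPassCondFromRegular.lean`);

and the arithmetic `(2^{a+b} + (2^b − 1)(2^{r} − 1)) · n / 2ⁿ ≤ 2 · 2^{−2α'⌊log₂ n⌋}` for
`a = min r L`, `b = L − a`, `L = n − (2α'+1)⌊log₂ n⌋ − 1` (both cases `r ≤ L`, `r > L`), whence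
`Δ ≤ 2^{−α'⌊log₂ n⌋} ≤ 2^{α'}/n^{α'} ≤ 3/n^{α'/2}` for `n ≥ 4` (`half_sqrt_le`, `distUnif_GG_le_three`). All proved.

## References

* Y. Liu, R. Pass, *On one-way functions and Kolmogorov complexity*, FOCS 2020
  (arXiv:2009.11514), Lemma 5.3 (density) and Appendix (its proof).
* S. Arora, B. Barak, *Computational Complexity: A Modern Approach*, CUP 2009, Lemma 21.26.
-/

namespace Literature.Computability.Cryptography

open Finset Filter _root_.Computability Complexity AffineStr

/-! ### Two more invariances of the distance from uniform -/

namespace LeftoverHash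

variable {ι β ε : Type*} [DecidableEq β] [DecidableEq ε] [Fintype ε]

/-- **Independent uniform pass-through coordinates do not change the distance from uniform**:
`Δ((g(X), E), U_{T × ε}) = Δ(g(X), U_T)` for `E` uniform on `ε`, independent of `X`. [folklore] -/
theorem distUnif_prod_right [Nonempty ε] (D : Finset ι) (g : ι → β) (T : Finset β) :
    distUnif (D ×ˢ (Finset.univ : Finset ε)) (fun p => (g p.1, p.2)) (T ×ˢ (Finset.univ : Finset ε)) = distUnif D g T := by
  classical
  have hε : (0 : ℝ) < Fintype.card ε := by exact_mod_cast Fintype.card_pos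
  -- fibres: `fib (v, e) = fib v × {e}`
  have hfib : ∀ (v : β) (e : ε), (fib (D ×ˢ (Finset.univ : Finset ε)) (fun p => (g p.1, p.2)) (v, e)).card = (fib D g v).card := by
    intro v e
    have h : fib (D ×ˢ (Finset.univ : Finset ε)) (fun p => (g p.1, p.2)) (v, e) = fib D g v ×ˢ {e} := by
      ext ⟨x, e'⟩
      simp only [mem_fib, Finset.mem_product, Finset.mem_univ, and_true, Prod.mk.injEq, Finset.mem_singleton]
      tauto
    rw [h, Finset.card_product, Finset.card_singleton, mul_one]
  have hprob : ∀ (v : β) (e : ε), prob (D ×ˢ (Finset.univ : Finset ε)) (fun p => (g p.1, p.2)) (v, e) = prob D g v / Fintype.card ε := by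
    intro v e
    unfold prob
    rw [hfib, Finset.card_product, Finset.card_univ, Nat.cast_mul, div_div]
  unfold distUnif
  congr 1
  rw [Finset.sum_product]
  refine Finset.sum_congr rfl fun v _ => ?_
  rw [Finset.sum_congr rfl fun e _ => by rw [hprob v e], Finset.sum_const, Finset.card_univ, nsmul_eq_mul,
    Finset.card_product, Finset.card_univ, Nat.cast_mul]
  rw [show prob D g v / Fintype.card ε - 1 / (T.card * Fintype.card ε) = (prob D g v - 1 / T.card) / Fintype.card ε by
    field_simp]
  rw [abs_div, abs_of_pos hε, mul_div_cancel₀ _ hε.ne']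

end LeftoverHash

/-! ### The finite-sum distance `sdUnif` is `distUnif` against the full cube -/

/-- All strings of length `ℓ`, as a `Finset`. [folklore] -/
noncomputable def allStr (ℓ : ℕ) : Finset (List Bool) :=
  Finset.univ.image (List.Vector.toList : List.Vector Bool ℓ → List Bool)

/-- Membership in `allStr`. [folklore] -/
@[simp] theorem mem_allStr {ℓ : ℕ} {v : List Bool} : v ∈ allStr ℓ ↔ v.length = ℓ := by
  unfold allStr
  simp only [Finset.mem_image, Finset.mem_univ, true_and]
  exact ⟨fun ⟨w, hw⟩ => hw ▸ w.toList_length, fun h => ⟨⟨v, h⟩, rfl⟩⟩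

/-- `|allStr ℓ| = 2^ℓ`. [folklore] -/
@[simp] theorem card_allStr (ℓ : ℕ) : (allStr ℓ).card = 2 ^ ℓ := by
  unfold allStr
  rw [Finset.card_image_of_injective _ List.Vector.toList_injective, Finset.card_univ, card_vector, Fintype.card_bool]

/-- **`sdUnif S F ℓ = distUnif S F (allStr ℓ)`** when `F` maps `S` into strings of length `ℓ`
(the two finite-sum renderings of the statistical distance to `U_ℓ` agree). [folklore] -/
theorem sdUnif_eq_distUnif {ι : Type*} (S : Finset ι) (F : ι → List Bool) {ℓ : ℕ} (hF : ∀ x ∈ S, (F x).length = ℓ) :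
    sdUnif S F ℓ = LeftoverHash.distUnif S F (allStr ℓ) := by
  classical
  have hsupp : sdSupport S F ℓ = allStr ℓ := by
    unfold sdSupport allStr
    refine Finset.union_eq_right.2 fun v hv => ?_
    obtain ⟨x, hx, rfl⟩ := Finset.mem_image.1 hv
    exact mem_allStr.2 (hF x hx)
  unfold sdUnif LeftoverHash.distUnif
  rw [hsupp, card_allStr]
  congr 1
  refine Finset.sum_congr rfl fun v hv => ?_
  rw [mem_allStr] at hv
  unfold imgProb unifProb LeftoverHash.prob fiber LeftoverHash.fib
  rw [if_pos hv, Nat.cast_pow, Nat.cast_ofNat, one_div]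

/-- An injective map into strings of length `ℓ` from a set of size `2^ℓ` is **onto** the cube. [folklore] -/
theorem image_eq_allStr {α : Type*} [DecidableEq α] {T : Finset α} {Φ : α → List Bool} {ℓ : ℕ} (hΦ : Set.InjOn Φ T)
    (hlen : ∀ t ∈ T, (Φ t).length = ℓ) (hcard : T.card = 2 ^ ℓ) : T.image Φ = allStr ℓ := by
  refine Finset.eq_of_subset_of_card_le (fun v hv => ?_) ?_
  · obtain ⟨t, ht, rfl⟩ := Finset.mem_image.1 hv
    exact mem_allStr.2 (hlen t ht)
  · rw [card_allStr, Finset.card_image_of_injOn hΦ, hcard]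

/-! ### Injectivity of the padding -/

namespace L53Params

variable (Q : L53Params)

/-- The padded string, spelled out: `y ‖ 1 ‖ 0^{M − |y| − 1}`. [folklore] -/
theorem pad_eq {n : ℕ} {y : List Bool} (hy : y.length + 1 ≤ Q.M n) :
    Q.pad n y = y ++ true :: List.replicate (Q.M n - (y.length + 1)) false := by
  unfold pad CondParams.fitLen
  rw [List.take_append, List.take_of_length_le (by simp; omega), List.take_replicate, List.length_append,
    List.length_singleton, min_eq_left (Nat.sub_le _ _), List.append_assoc, List.singleton_append]

/-- Strings with their marker at different positions differ. [folklore] -/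
theorem marker_ne {u u' : List Bool} {p p' : ℕ} (hlt : u.length < u'.length) :
    u ++ true :: List.replicate p false ≠ u' ++ true :: List.replicate p' false := by
  intro heq
  have h : (u ++ true :: List.replicate p false)[u'.length]? = (u' ++ true :: List.replicate p' false)[u'.length]? := by rw [heq]
  rw [List.getElem?_append_right hlt.le, List.getElem?_append_right le_rfl, Nat.sub_self, List.getElem?_cons_zero] at h
  obtain ⟨d, hd⟩ : ∃ d, u'.length - u.length = d + 1 := ⟨u'.length - u.length - 1, by omega⟩
  rw [hd, List.getElem?_cons_succ, List.getElem?_replicate] at h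
  split_ifs at h; simp at h

/-- **The padding is injective on strings shorter than `M`.** [folklore] -/
theorem pad_injective {n : ℕ} {y y' : List Bool} (hy : y.length + 1 ≤ Q.M n) (hy' : y'.length + 1 ≤ Q.M n)
    (h : Q.pad n y = Q.pad n y') : y = y' := by
  rw [Q.pad_eq hy, Q.pad_eq hy'] at h
  rcases lt_trichotomy y.length y'.length with hlt | heq | hgt
  · exact absurd h (marker_ne hlt)
  · exact (List.append_inj h heq).1
  · exact absurd h.symm (marker_ne hgt)

/-! ### The decomposition of seeds and outputs -/

/-- Junk length `J = m − R₁ − R₂`. [folklore] -/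
def J (n : ℕ) : ℕ := Q.m n - R₁ n - Q.R₂ n

/-- `f x`, padded, as a vector of length `M n`. [folklore] -/
def padV (n : ℕ) (x : List.Vector Bool n) : List.Vector Bool (Q.M n) := ⟨Q.pad n (Q.f x.toList), Q.length_pad _ _⟩

/-- The first hash family `h¹ : {0,1}ⁿ → 𝔽₂^a`, keyed by `R₁`. [folklore] -/
def h₁ (i n : ℕ) (σ : List.Vector Bool (R₁ n)) (x : List.Vector Bool n) : Fin (Q.aOf i n) → ZMod 2 :=
  hashV n (Q.aOf i n) σ.toList x

/-- The second hash family `h² : {0,1}^M → 𝔽₂^b`, keyed by `R₂`. [folklore] -/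
def h₂ (i n : ℕ) (σ : List.Vector Bool (Q.R₂ n)) (y : List.Vector Bool (Q.M n)) : Fin (Q.bOf i n) → ZMod 2 :=
  hashV (Q.M n) (Q.bOf i n) σ.toList y

/-- The seed with components `((R₁, R₂), x, (junk, τ))`: `x ‖ R₁ ‖ R₂ ‖ junk ‖ τ` (`|τ| = t`, the
pass-through suffix: `σ_GL`, or `σ_GL ‖ u` for the ideal Goldreich–Levin sample). [folklore] -/
def seedMap (n t : ℕ) (p : ((List.Vector Bool (R₁ n) × List.Vector Bool (Q.R₂ n)) × List.Vector Bool n) ×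
    (List.Vector Bool (Q.J n) × List.Vector Bool t)) : List Bool :=
  p.1.2.toList ++ (p.1.1.1.toList ++ (p.1.1.2.toList ++ (p.2.1.toList ++ p.2.2.toList)))

/-- The output recoded from `(((R₁, R₂), (v₁, v₂)), (junk, τ))`: `R₁ ‖ R₂ ‖ junk ‖ v₁ ‖ v₂ ‖ τ`. [folklore] -/
def outMap (i n t : ℕ) (q : ((List.Vector Bool (R₁ n) × List.Vector Bool (Q.R₂ n)) ×
    ((Fin (Q.aOf i n) → ZMod 2) × (Fin (Q.bOf i n) → ZMod 2))) × (List.Vector Bool (Q.J n) × List.Vector Bool t)) :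
    List Bool :=
  q.1.1.1.toList ++ (q.1.1.2.toList ++ (q.2.1.toList ++ (encZ _ q.1.2.1 ++ (encZ _ q.1.2.2 ++ q.2.2.toList))))

variable {Q}

/-- Region bookkeeping: `R₁ + R₂ + J = m` when the regions fit. [folklore] -/
theorem regions_eq {n : ℕ} (hfit : R₁ n + Q.R₂ n ≤ Q.m n) : R₁ n + Q.R₂ n + Q.J n = Q.m n := by
  unfold J; omega

/-- `m + k·n = 3n^c` for `n ≥ γ'`. [folklore] -/
theorem m_add_kk {n : ℕ} (hn : Q.γ' ≤ n) : Q.m n + Q.kk n * n = Q.tot n := by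
  have := Q.kk_mul_le_tot hn; unfold m; omega

variable (Q)

/-- **The hiding core with a pass-through suffix**: on `w = x ‖ ρ ‖ τ` (`|x| = n`, `|ρ| = m(n)`),
`GG n i w = gcore n i x ρ ‖ τ`. By definition `F i w = GG (nOf |w|) i w` (`F_eq_GG`); the ideal
Goldreich–Levin sample `glIdeal (g r) (m n) n` is `GG n (r n)` as well (`glIdeal_eq_GG`), which is why
the density bound below is proved for `GG` with an arbitrary suffix length `t`. [folklore] -/
def GG (n i : ℕ) (w : List Bool) : List Bool :=
  Q.gcore n i (w.take n) ((w.drop n).take (Q.m n)) ++ (w.drop n).drop (Q.m n)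

variable {Q}

/-- `F i w = GG (nOf |w|) i w`. [folklore] -/
theorem F_eq_GG (i : ℕ) (w : List Bool) : Q.F i w = Q.GG (Q.nOf w.length) i w := rfl

/-- `|GG n i w| = |w| − n + L` for `|w| ≥ n + m`. [folklore] -/
theorem length_GG {n i : ℕ} {w : List Bool} (hw : n + Q.m n ≤ w.length) : (Q.GG n i w).length = w.length - n + Q.L n := by
  simp only [GG, List.length_append, Q.length_gcore, List.length_take, List.length_drop]
  omega

/-- **The ideal Goldreich–Levin sample is `GG`**: `glIdeal (g r) (m n) n w = GG n (r n) w` for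
`|w| ≥ n + m(n)`, `n ≥ γ'`. [folklore] -/
theorem glIdeal_eq_GG {r : ℕ → ℕ} {n : ℕ} (hn : Q.γ' ≤ n) {w : List Bool} (hw : n + Q.m n ≤ w.length) :
    glIdeal (Q.g r) (Q.m n) n w = Q.GG n (r n) w := by
  have hlen : (w.take (n + Q.m n)).length = n + Q.m n := by rw [List.length_take]; exact min_eq_left hw
  have hG : Q.nOfG (w.take (n + Q.m n)).length = n := by rw [hlen, Q.nOfG_eq hn]
  have h1 : (w.take (n + Q.m n)).take n = w.take n := by rw [List.take_take, min_eq_left (Nat.le_add_right _ _)]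
  have h2 : (w.take (n + Q.m n)).drop n = (w.drop n).take (Q.m n) := by rw [List.drop_take, Nat.add_sub_cancel_left]
  have h3 : (w.drop n).drop (Q.m n) = w.drop (n + Q.m n) := by rw [List.drop_drop]
  simp only [glIdeal, g, hG, h1, h2, GG, h3]

/-- **`f'_i` on a decomposed seed is the recoded output of the doubly keyed hash.** [Y. Liu, R. Pass,
FOCS 2020, Appendix (`REAL = R_GL ‖ R₁ ‖ R₂ ‖ [h_{R₁}(X)] ‖ [h_{R₂}(f X)]`)] [folklore] -/
theorem GG_seedMap {i n t : ℕ} (hfit : R₁ n + Q.R₂ n ≤ Q.m n)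
    (p : ((List.Vector Bool (R₁ n) × List.Vector Bool (Q.R₂ n)) × List.Vector Bool n) ×
      (List.Vector Bool (Q.J n) × List.Vector Bool t)) :
    Q.GG n i (Q.seedMap n t p) = Q.outMap i n t (LeftoverHash.keyed₂ (Q.h₁ i n) (Q.h₂ i n) (Q.padV n) p.1, p.2) := by
  obtain ⟨⟨⟨k₁, k₂⟩, x⟩, ⟨j, σ⟩⟩ := p
  have hreg := regions_eq hfit
  set ρ : List Bool := k₁.toList ++ (k₂.toList ++ j.toList) with hρ
  have hρlen : ρ.length = Q.m n := by
    simp only [hρ, List.length_append, List.Vector.toList_length]; omega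
  have e0 : Q.seedMap n t (((k₁, k₂), x), (j, σ)) = x.toList ++ (ρ ++ σ.toList) := by
    simp [seedMap, hρ, List.append_assoc]
  have e1 : (x.toList ++ (ρ ++ σ.toList)).take n = x.toList := by
    rw [List.take_append_of_le_length (by simp)]; simp
  have e2 : (x.toList ++ (ρ ++ σ.toList)).drop n = ρ ++ σ.toList := by
    rw [List.drop_append_of_le_length (by simp)]; simp
  have e3 : (ρ ++ σ.toList).take (Q.m n) = ρ := by
    rw [List.take_append_of_le_length (by omega), List.take_of_length_le (by omega)]
  have e4 : (ρ ++ σ.toList).drop (Q.m n) = σ.toList := by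
    rw [List.drop_append_of_le_length (by omega), List.drop_of_length_le (by omega), List.nil_append]
  have e5 : ρ.take (R₁ n) = k₁.toList := by
    rw [hρ, List.take_append_of_le_length (by simp)]; simp
  have e6 : (ρ.drop (R₁ n)).take (Q.R₂ n) = k₂.toList := by
    rw [hρ, List.drop_append_of_le_length (by simp), List.drop_of_length_le (by simp), List.nil_append,
      List.take_append_of_le_length (by simp)]
    simp
  have e7 : Q.pad n (Q.f x.toList) = (Q.padV n x).toList := rfl
  rw [GG, e0, e1, e2, e3, e4, gcore, e5, e6, e7, hashStr_toList, hashStr_toList]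
  simp only [outMap, LeftoverHash.keyed₂, h₁, h₂, hρ, List.append_assoc]

/-- `seedMap` is injective (fixed block lengths). [folklore] -/
theorem seedMap_injective (n t : ℕ) : Function.Injective (Q.seedMap n t) := by
  rintro ⟨⟨⟨k₁, k₂⟩, x⟩, ⟨j, σ⟩⟩ ⟨⟨⟨k₁', k₂'⟩, x'⟩, ⟨j', σ'⟩⟩ h
  simp only [seedMap] at h
  obtain ⟨hx, h⟩ := List.append_inj h (by simp)
  obtain ⟨hk₁, h⟩ := List.append_inj h (by simp)
  obtain ⟨hk₂, h⟩ := List.append_inj h (by simp)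
  obtain ⟨hj, hσ⟩ := List.append_inj h (by simp)
  rw [List.Vector.toList_injective hx, List.Vector.toList_injective hk₁, List.Vector.toList_injective hk₂,
    List.Vector.toList_injective hj, List.Vector.toList_injective hσ]

/-- `outMap` is injective (fixed block lengths, `encZ` injective). [folklore] -/
theorem outMap_injective (i n t : ℕ) : Function.Injective (Q.outMap i n t) := by
  rintro ⟨⟨⟨k₁, k₂⟩, ⟨v₁, v₂⟩⟩, ⟨j, σ⟩⟩ ⟨⟨⟨k₁', k₂'⟩, ⟨v₁', v₂'⟩⟩, ⟨j', σ'⟩⟩ h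
  simp only [outMap] at h
  obtain ⟨hk₁, h⟩ := List.append_inj h (by simp)
  obtain ⟨hk₂, h⟩ := List.append_inj h (by simp)
  obtain ⟨hj, h⟩ := List.append_inj h (by simp)
  obtain ⟨hv₁, h⟩ := List.append_inj h (by simp)
  obtain ⟨hv₂, hσ⟩ := List.append_inj h (by simp)
  rw [List.Vector.toList_injective hk₁, List.Vector.toList_injective hk₂, encZ_injective _ hv₁, encZ_injective _ hv₂,
    List.Vector.toList_injective hj, List.Vector.toList_injective hσ]

variable (Q)

/-- The domain of the joint Leftover Hash Lemma: all key pairs, points in `S_n`. [folklore] -/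
def dom (S : ∀ n : ℕ, Finset (List.Vector Bool n)) (n : ℕ) :
    Finset ((List.Vector Bool (R₁ n) × List.Vector Bool (Q.R₂ n)) × List.Vector Bool n) :=
  (Finset.univ ×ˢ Finset.univ) ×ˢ S n

variable {Q}

/-- **The decomposed seeds are exactly the block seeds `x ‖ τ'`, `|τ'| = m + t`.** [folklore] -/
theorem image_seedMap (S : ∀ n : ℕ, Finset (List.Vector Bool n)) {n : ℕ} (t : ℕ) (hfit : R₁ n + Q.R₂ n ≤ Q.m n) :
    (Q.dom S n ×ˢ (Finset.univ : Finset (List.Vector Bool (Q.J n) × List.Vector Bool t))).image (Q.seedMap n t) =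
      blockSeeds S (Q.m n + t) n := by
  classical
  have hreg := regions_eq hfit
  refine Finset.eq_of_subset_of_card_le (fun w hw => ?_) ?_
  · obtain ⟨⟨⟨⟨k₁, k₂⟩, x⟩, ⟨j, σ⟩⟩, hp, rfl⟩ := Finset.mem_image.1 hw
    have hx : x ∈ S n := (Finset.mem_product.1 (Finset.mem_product.1 hp).1).2
    refine mem_blockSeeds_iff.2 ⟨x, hx, ⟨k₁.toList ++ (k₂.toList ++ (j.toList ++ σ.toList)), ?_⟩, ?_⟩
    · simp only [List.length_append, List.Vector.toList_length]; omega
    · simp [seedMap]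
  · rw [Finset.card_image_of_injective _ (Q.seedMap_injective n t), card_blockSeeds]
    simp only [dom, Finset.card_product, Finset.card_univ, card_vector, Fintype.card_bool, Fintype.card_prod]
    have : 2 ^ (Q.m n + t) = 2 ^ R₁ n * 2 ^ Q.R₂ n * (2 ^ Q.J n * 2 ^ t) := by
      rw [← pow_add, ← pow_add, ← pow_add]; congr 1; omega
    rw [this]
    exact le_of_eq (by ring)

/-- The output length `ℓ = m + t + L`. [folklore] -/
theorem length_outMap {i n t : ℕ} (hfit : R₁ n + Q.R₂ n ≤ Q.m n)
    (q : ((List.Vector Bool (R₁ n) × List.Vector Bool (Q.R₂ n)) × ((Fin (Q.aOf i n) → ZMod 2) × (Fin (Q.bOf i n) → ZMod 2))) ×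
      (List.Vector Bool (Q.J n) × List.Vector Bool t)) :
    (Q.outMap i n t q).length = Q.m n + t + Q.L n := by
  have hreg := regions_eq hfit
  have hab := Q.aOf_add_bOf i n
  simp only [outMap, List.length_append, List.Vector.toList_length, length_encZ]
  omega

/-- **The recoded outputs of the full cube are all strings of length `ℓ`.** [folklore] -/
theorem image_outMap {i n t : ℕ} (hfit : R₁ n + Q.R₂ n ≤ Q.m n) :
    (((Finset.univ ×ˢ Finset.univ) ×ˢ Finset.univ : Finset ((List.Vector Bool (R₁ n) × List.Vector Bool (Q.R₂ n)) ×
        ((Fin (Q.aOf i n) → ZMod 2) × (Fin (Q.bOf i n) → ZMod 2)))) ×ˢ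
      (Finset.univ : Finset (List.Vector Bool (Q.J n) × List.Vector Bool t))).image (Q.outMap i n t) =
      allStr (Q.m n + t + Q.L n) := by
  classical
  have hreg := regions_eq hfit
  have hab := Q.aOf_add_bOf i n
  refine image_eq_allStr (fun a _ b _ h => Q.outMap_injective i n t h) (fun q _ => length_outMap hfit q) ?_
  simp only [Finset.card_product, Finset.card_univ, card_vector, Fintype.card_bool, Fintype.card_prod, Fintype.card_fun,
    ZMod.card, Fintype.card_fin]
  rw [← pow_add, ← pow_add, ← pow_add, ← pow_add, ← pow_add]
  congr 1
  omega

/-! ### The joint Leftover Hash Lemma applied -/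

/-- Fibres of the padded `f` inside `S_n` are bounded by the regularity bound. [folklore] -/
theorem fibre_padV_le (S : ∀ n : ℕ, Finset (List.Vector Bool n)) {r : ℕ → ℕ} {n : ℕ}
    (hP : ∀ x : List Bool, (Q.f x).length ≤ Q.P.eval x.length)
    (hreg : ∀ x ∈ S n, preimCard Q.f n x.toList ≤ 2 ^ r n) (x : List.Vector Bool n) (hx : x ∈ S n) :
    ((S n).filter fun x' => Q.padV n x' = Q.padV n x).card ≤ 2 ^ r n := by
  classical
  refine le_trans (Finset.card_le_card fun x' hx' => ?_) (hreg x hx)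
  rw [Finset.mem_filter] at hx'
  have h := congrArg List.Vector.toList hx'.2
  simp only [padV, List.Vector.toList_mk] at h
  have hlen : ∀ z : List.Vector Bool n, (Q.f z.toList).length + 1 ≤ Q.M n := fun z => by
    have := hP z.toList; rw [List.Vector.toList_length] at this; unfold M; omega
  have hf : Q.f x'.toList = Q.f x.toList := Q.pad_injective (hlen x') (hlen x) h
  exact Finset.mem_filter.2 ⟨Finset.mem_univ _, hf⟩

/-- **`Δ(f'_i(seed), U_ℓ) ≤ ½ √((2^a 2^b + (2^b − 1)(2^{r n} − 1)) / |S_n|)`** (the finite-sum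
distance, by the sharp joint LHL after the re-indexing and recoding). [Y. Liu, R. Pass, FOCS 2020,
Appendix (density); Arora–Barak 2009, Lemma 21.26] [folklore] -/
theorem distUnif_GG_le (S : ∀ n : ℕ, Finset (List.Vector Bool n)) {r : ℕ → ℕ} {n : ℕ} (i t : ℕ)
    (hfit : R₁ n + Q.R₂ n ≤ Q.m n) (hS : (S n).Nonempty)
    (hP : ∀ x : List Bool, (Q.f x).length ≤ Q.P.eval x.length) (hreg : ∀ x ∈ S n, preimCard Q.f n x.toList ≤ 2 ^ r n)
    (ha : Q.aOf i n * (n + 1) ≤ R₁ n) (hb : Q.bOf i n * (Q.M n + 1) ≤ Q.R₂ n) :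
    LeftoverHash.distUnif (blockSeeds S (Q.m n + t) n) (Q.GG n i) (allStr (Q.m n + t + Q.L n)) ≤
      2⁻¹ * Real.sqrt ((2 ^ Q.aOf i n * 2 ^ Q.bOf i n + (2 ^ Q.bOf i n - 1) * (2 ^ r n - 1 : ℕ)) / (S n).card) := by
  classical
  -- re-index the seeds
  rw [← image_seedMap S t hfit, LeftoverHash.distUnif_image ((Q.seedMap_injective n t).injOn)]
  -- the map is the recoded doubly keyed hash
  have hfun : (Q.GG n i ∘ Q.seedMap n t) = Q.outMap i n t ∘ fun p => (LeftoverHash.keyed₂ (Q.h₁ i n) (Q.h₂ i n) (Q.padV n) p.1, p.2) :=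
    funext fun p => GG_seedMap hfit p
  rw [hfun, ← image_outMap (i := i) (t := t) hfit, LeftoverHash.distUnif_comp_of_injective _ _ (Q.outMap_injective i n t)]
  have key : LeftoverHash.distUnif (Q.dom S n ×ˢ (Finset.univ : Finset (List.Vector Bool (Q.J n) × List.Vector Bool t)))
      (fun p => (LeftoverHash.keyed₂ (Q.h₁ i n) (Q.h₂ i n) (Q.padV n) p.1, p.2))
      (((Finset.univ ×ˢ Finset.univ) ×ˢ (Finset.univ : Finset ((Fin (Q.aOf i n) → ZMod 2) × (Fin (Q.bOf i n) → ZMod 2)))) ×ˢ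
        (Finset.univ : Finset (List.Vector Bool (Q.J n) × List.Vector Bool t))) =
      LeftoverHash.distUnif (Q.dom S n) (LeftoverHash.keyed₂ (Q.h₁ i n) (Q.h₂ i n) (Q.padV n))
        ((Finset.univ ×ˢ Finset.univ) ×ˢ (Finset.univ : Finset ((Fin (Q.aOf i n) → ZMod 2) × (Fin (Q.bOf i n) → ZMod 2)))) := by
    convert LeftoverHash.distUnif_prod_right (ε := List.Vector Bool (Q.J n) × List.Vector Bool t)
      (Q.dom S n) (LeftoverHash.keyed₂ (Q.h₁ i n) (Q.h₂ i n) (Q.padV n))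
      ((Finset.univ ×ˢ Finset.univ) ×ˢ (Finset.univ : Finset ((Fin (Q.aOf i n) → ZMod 2) × (Fin (Q.bOf i n) → ZMod 2)))) using 3
  refine key.trans_le ?_
  -- the sharp joint LHL
  have h1 := isPairwiseIndep_hashV (k := Q.aOf i n) ha (S n)
  have h2 := isPairwiseIndep_hashV (k := Q.bOf i n) hb ((S n).image (Q.padV n))
  have hmain := LeftoverHash.leftoverHash_joint_sharp_of_fibre_le (K₁ := (Finset.univ : Finset (List.Vector Bool (R₁ n))))
    (K₂ := (Finset.univ : Finset (List.Vector Bool (Q.R₂ n)))) Finset.univ_nonempty Finset.univ_nonempty hS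
    (h₁ := Q.h₁ i n) (h₂ := Q.h₂ i n) (f := Q.padV n) h1 h2 (fibre_padV_le S hP hreg)
  simp only [Fintype.card_fun, ZMod.card, Fintype.card_fin, Nat.cast_pow, Nat.cast_ofNat] at hmain
  exact hmain

/-! ### Arithmetic -/

/-- The collision numerator is at most `2 · 2^L` in both cases `i ≤ L` and `i > L`. [folklore] -/
theorem numer_le (i n : ℕ) :
    2 ^ Q.aOf i n * 2 ^ Q.bOf i n + (2 ^ Q.bOf i n - 1) * (2 ^ i - 1) ≤ 2 * 2 ^ Q.L n := by
  have hab := Q.aOf_add_bOf i n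
  rw [← pow_add, hab]
  by_cases h : i ≤ Q.L n
  · have ha : Q.aOf i n = i := min_eq_left h
    have hbi : Q.bOf i n + i = Q.L n := by omega
    calc 2 ^ Q.L n + (2 ^ Q.bOf i n - 1) * (2 ^ i - 1) ≤ 2 ^ Q.L n + 2 ^ Q.bOf i n * 2 ^ i :=
          Nat.add_le_add_left (Nat.mul_le_mul (Nat.sub_le _ _) (Nat.sub_le _ _)) _
      _ = 2 * 2 ^ Q.L n := by rw [← pow_add, hbi]; ring
  · have ha : Q.aOf i n = Q.L n := min_eq_right (by omega)
    have hb : Q.bOf i n = 0 := by unfold bOf; omega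
    rw [hb]
    simp

/-- `2ⁿ = 2^L · 2^{(2α'+1)⌊log₂ n⌋ + 1}` under the slack hypotheses. [folklore] -/
theorem two_pow_n_eq {n : ℕ} (hslack : 2 * Q.α' * Nat.log 2 n ≤ lpS53 n) (hn : 1 ≤ n) :
    (2 : ℝ) ^ n = 2 ^ Q.L n * (2 * (2 ^ Nat.log 2 n * (2 ^ Nat.log 2 n) ^ (2 * Q.α'))) := by
  have hlog : Nat.log 2 n + 1 ≤ n := by
    have := Nat.log_lt_self 2 (by omega : n ≠ 0); omega
  have hL : Q.L n + (2 * Q.α' * Nat.log 2 n + Nat.log 2 n + 1) = n := by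
    unfold L; unfold lpS53 at *; omega
  conv_lhs => rw [← hL]
  rw [pow_add, ← pow_mul]
  congr 1
  rw [show 2 * Q.α' * Nat.log 2 n + Nat.log 2 n + 1 = (Nat.log 2 n + Nat.log 2 n * (2 * Q.α')) + 1 by ring, pow_succ,
    pow_add]
  ring

/-- **The real-analysis end of the density bound**: from `X ≤ 2 · 4^{α'} / n^{2α'}` to
`½ √X ≤ 3 / n^{α'/2}` for `n ≥ 4`. [folklore] -/
theorem half_sqrt_le {X : ℝ} {n α' : ℕ} (hn : 4 ≤ n) (_hX0 : 0 ≤ X) (hX : X ≤ 2 * 4 ^ α' / (n : ℝ) ^ (2 * α')) :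
    2⁻¹ * Real.sqrt X ≤ 3 / (n : ℝ) ^ ((α' : ℝ) / 2) := by
  have hn0 : (0 : ℝ) < n := by exact_mod_cast (show 0 < n by omega)
  have hn4 : (4 : ℝ) ≤ n := by exact_mod_cast hn
  set y : ℝ := (n : ℝ) ^ ((α' : ℝ) / 2) with hy
  have hypos : 0 < y := Real.rpow_pos_of_pos hn0 _
  have hy2 : y ^ 2 = (n : ℝ) ^ α' := by
    rw [hy, ← Real.rpow_natCast ((n : ℝ) ^ ((α' : ℝ) / 2)) 2, ← Real.rpow_mul hn0.le, Nat.cast_ofNat,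
      div_mul_cancel₀ _ (two_ne_zero), Real.rpow_natCast]
  have hy4 : (2 : ℝ) ^ α' ≤ y := by
    have h42 : (4 : ℝ) ^ ((α' : ℝ) / 2) = 2 ^ α' := by
      rw [show (4 : ℝ) = 2 ^ (2 : ℝ) by norm_num, ← Real.rpow_mul (by norm_num), mul_div_cancel₀ _ (two_ne_zero),
        Real.rpow_natCast]
    rw [← h42, hy]
    exact Real.rpow_le_rpow (by norm_num) hn4 (by positivity)
  -- `√X ≤ √2 · 2^{α'} / n^{α'}`
  have hsq : Real.sqrt X ≤ Real.sqrt 2 * 2 ^ α' / (n : ℝ) ^ α' := by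
    have h1 : Real.sqrt X ≤ Real.sqrt (2 * 4 ^ α' / (n : ℝ) ^ (2 * α')) := Real.sqrt_le_sqrt hX
    refine h1.trans (le_of_eq ?_)
    rw [Real.sqrt_eq_iff_mul_self_eq_of_pos (by positivity), div_mul_div_comm, mul_mul_mul_comm, Real.mul_self_sqrt (by norm_num),
      ← mul_pow, ← pow_add, ← two_mul]
    norm_num
  have hs2 : Real.sqrt 2 ≤ 2 := by
    rw [show (2 : ℝ) = Real.sqrt 4 by rw [show (4 : ℝ) = 2 ^ 2 by norm_num, Real.sqrt_sq (by norm_num)]]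
    exact Real.sqrt_le_sqrt (by norm_num)
  -- `2^{α'} / n^{α'} = 2^{α'} / y² ≤ 1 / y ≤ 3 / y`
  calc 2⁻¹ * Real.sqrt X ≤ 2⁻¹ * (Real.sqrt 2 * 2 ^ α' / (n : ℝ) ^ α') := by gcongr
    _ ≤ 2⁻¹ * (2 * 2 ^ α' / (n : ℝ) ^ α') := by gcongr
    _ = 2 ^ α' / y ^ 2 := by rw [hy2]; ring
    _ ≤ y / y ^ 2 := by gcongr
    _ = 1 / y := by field_simp
    _ ≤ 3 / y := by gcongr; norm_num

/-- **The density bound, per `n`.** [Y. Liu, R. Pass, FOCS 2020, Lemma 5.3 (density) / Appendix]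
[folklore] -/
theorem distUnif_GG_le_three (S : ∀ n : ℕ, Finset (List.Vector Bool n)) {r : ℕ → ℕ} {n : ℕ} (t : ℕ) (hn4 : 4 ≤ n)
    (hfit : R₁ n + Q.R₂ n ≤ Q.m n) (hslack : 2 * Q.α' * Nat.log 2 n ≤ lpS53 n)
    (hdense : 2 ^ n ≤ n * (S n).card)
    (hP : ∀ x : List Bool, (Q.f x).length ≤ Q.P.eval x.length) (hreg : ∀ x ∈ S n, preimCard Q.f n x.toList ≤ 2 ^ r n) :
    LeftoverHash.distUnif (blockSeeds S (Q.m n + t) n) (Q.GG n (r n)) (allStr (Q.m n + t + Q.L n)) ≤ 3 / (n : ℝ) ^ ((Q.α' : ℝ) / 2) := by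
  have hcard : 0 < (S n).card := by
    by_contra h; push Not at h
    have : (S n).card = 0 := by omega
    rw [this, Nat.mul_zero] at hdense
    exact absurd hdense (not_le.2 (Nat.two_pow_pos n))
  have hS : (S n).Nonempty := Finset.card_pos.1 hcard
  have ha : Q.aOf (r n) n * (n + 1) ≤ R₁ n := by
    unfold R₁; exact Nat.mul_le_mul_right _ ((min_le_right _ _).trans (Q.L_le n))
  have hb : Q.bOf (r n) n * (Q.M n + 1) ≤ Q.R₂ n := by
    unfold R₂; exact Nat.mul_le_mul_right _ ((Nat.sub_le _ _).trans (Q.L_le n))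
  have hb1 : (1 : ℝ) ≤ 2 ^ Q.bOf (r n) n := one_le_pow₀ (by norm_num)
  have hX0 : 0 ≤ ((2 : ℝ) ^ Q.aOf (r n) n * 2 ^ Q.bOf (r n) n + (2 ^ Q.bOf (r n) n - 1) * ((2 ^ r n - 1 : ℕ) : ℝ)) / (S n).card :=
    div_nonneg (add_nonneg (by positivity) (mul_nonneg (by linarith) (Nat.cast_nonneg _))) (Nat.cast_nonneg _)
  refine (distUnif_GG_le S (r n) t hfit hS hP hreg ha hb).trans (half_sqrt_le hn4 hX0 ?_)
  -- `X ≤ 2 · 2^L · n / 2ⁿ ≤ 2 · 4^{α'} / n^{2α'}`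
  have hnum := numer_le (Q := Q) (r n) n
  have hnumR : (2 : ℝ) ^ Q.aOf (r n) n * 2 ^ Q.bOf (r n) n + (2 ^ Q.bOf (r n) n - 1) * ((2 ^ r n - 1 : ℕ) : ℝ) ≤ 2 * 2 ^ Q.L n := by
    have h' : ((2 ^ Q.aOf (r n) n * 2 ^ Q.bOf (r n) n + (2 ^ Q.bOf (r n) n - 1) * (2 ^ r n - 1) : ℕ) : ℝ) ≤ ((2 * 2 ^ Q.L n : ℕ) : ℝ) := by
      exact_mod_cast hnum
    rw [Nat.cast_add, Nat.cast_mul, Nat.cast_mul, Nat.cast_sub Nat.one_le_two_pow, Nat.cast_pow, Nat.cast_pow, Nat.cast_mul,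
      Nat.cast_pow] at h'
    simpa using h'
  have hSR : (0 : ℝ) < (S n).card := by exact_mod_cast hcard
  have hn0 : (0 : ℝ) < n := by exact_mod_cast (show 0 < n by omega)
  have hdenseR : (2 : ℝ) ^ n ≤ n * (S n).card := by exact_mod_cast hdense
  have h2n := two_pow_n_eq (Q := Q) hslack (by omega)
  set T : ℝ := 2 ^ Nat.log 2 n with hT
  have hTpos : 0 < T := by positivity
  have hnT : (n : ℝ) < 2 * T := by
    have := Nat.lt_pow_succ_log_self (b := 2) (by norm_num) n
    rw [hT]; exact_mod_cast (by rw [pow_succ] at this; linarith)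
  -- `1/|S| ≤ n / 2ⁿ`
  have hinvS : 1 / ((S n).card : ℝ) ≤ n / 2 ^ n := by
    rw [div_le_div_iff₀ hSR (by positivity)]; linarith
  have hX : ((2 : ℝ) ^ Q.aOf (r n) n * 2 ^ Q.bOf (r n) n + (2 ^ Q.bOf (r n) n - 1) * ((2 ^ r n - 1 : ℕ) : ℝ)) / (S n).card ≤
      2 * 2 ^ Q.L n * (n / 2 ^ n) := by
    rw [div_eq_mul_one_div]
    exact mul_le_mul hnumR hinvS (by positivity) (by positivity)
  refine hX.trans ?_
  rw [h2n]
  -- `2·2^L·n / (2^L·2·T·T^{2α'}) = n / (T · T^{2α'}) ≤ 2 / T^{2α'} ≤ 2 · (2/n)^{2α'}`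
  have hL0 : (0 : ℝ) < 2 ^ Q.L n := by positivity
  have step1 : 2 * (2 : ℝ) ^ Q.L n * (n / (2 ^ Q.L n * (2 * (T * T ^ (2 * Q.α'))))) = n / (T * T ^ (2 * Q.α')) := by
    field_simp
  rw [step1]
  have step2 : (n : ℝ) / (T * T ^ (2 * Q.α')) ≤ 2 / T ^ (2 * Q.α') := by
    rw [div_le_div_iff₀ (by positivity) (by positivity)]
    nlinarith [hnT, pow_pos hTpos (2 * Q.α')]
  refine step2.trans ?_
  -- `T ≥ n/2`
  have hT2 : (n : ℝ) / 2 ≤ T := by linarith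
  rw [div_le_div_iff₀ (by positivity) (by positivity)]
  have : ((n : ℝ) / 2) ^ (2 * Q.α') ≤ T ^ (2 * Q.α') := pow_le_pow_left₀ (by positivity) hT2 _
  have h4 : (4 : ℝ) ^ Q.α' * ((n : ℝ) / 2) ^ (2 * Q.α') = (n : ℝ) ^ (2 * Q.α') := by
    rw [div_pow, pow_mul, pow_mul, show ((n : ℝ) ^ 2) = (n : ℝ) ^ 2 from rfl]
    field_simp
    ring
  nlinarith [this, pow_pos hn0 (2 * Q.α'), pow_pos (show (0 : ℝ) < 4 by norm_num) Q.α']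

/-- The regions fit into `ρ` for all large `n`: `n(n+1) + n(P(n)+2) ≤ 3n^c − γ'⌊log₂ n⌋ n`,
`c = deg P + 3`. [folklore] -/
theorem eventually_fit : ∀ᶠ n in atTop, R₁ n + Q.R₂ n ≤ Q.m n := by
  set C := Q.P.eval 1 with hC
  set d := Q.P.natDegree with hd
  filter_upwards [eventually_ge_atTop (Q.γ' + C + 4)] with n hn
  have hn1 : 1 ≤ n := by omega
  have hP : Q.P.eval n ≤ C * n ^ d := natPoly_eval_le_eval_one_mul_pow Q.P hn1
  have hc : Q.c = d + 3 := rfl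
  -- `R₁ + R₂ ≤ 4n² + C n^{d+1}`
  have h1 : R₁ n + Q.R₂ n ≤ 4 * n ^ 2 + C * n ^ (d + 1) := by
    unfold R₁ R₂ M
    calc n * (n + 1) + n * (Q.P.eval n + 1 + 1) ≤ n * (n + 1) + n * (C * n ^ d + 2) :=
          Nat.add_le_add_left (Nat.mul_le_mul_left _ (by omega)) _
      _ = n ^ 2 + 3 * n + C * n ^ (d + 1) := by ring
      _ ≤ 4 * n ^ 2 + C * n ^ (d + 1) := by nlinarith
  -- `γ' Λ n ≤ γ' n²`
  have h2 : Q.kk n * n ≤ Q.γ' * n ^ 2 := by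
    unfold kk
    have := Nat.log_le_self 2 n
    calc Q.γ' * Nat.log 2 n * n ≤ Q.γ' * n * n := by gcongr
      _ = Q.γ' * n ^ 2 := by ring
  -- `(4 + γ') n² ≤ n³ ≤ n^{d+3}` and `C n^{d+1} ≤ n^{d+3}`
  have h3 : (4 + Q.γ') * n ^ 2 ≤ n ^ (d + 3) := by
    calc (4 + Q.γ') * n ^ 2 ≤ n * n ^ 2 := Nat.mul_le_mul_right _ (by omega)
      _ = n ^ 3 := by ring
      _ ≤ n ^ (d + 3) := Nat.pow_le_pow_right hn1 (by omega)
  have h4 : C * n ^ (d + 1) ≤ n ^ (d + 3) := by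
    calc C * n ^ (d + 1) ≤ n ^ 2 * n ^ (d + 1) := Nat.mul_le_mul_right _ (by nlinarith)
      _ = n ^ (d + 3) := by ring
  have htot : Q.tot n = 3 * n ^ (d + 3) := by unfold tot; rw [hc]
  unfold m
  rw [htot]
  have : R₁ n + Q.R₂ n + Q.kk n * n ≤ 3 * n ^ (d + 3) := by nlinarith
  omega

/-! ### The density clause of Lemma 5.3 -/

/-- `sdUnif` depends only on the values of the map on the seed set. [folklore] -/
theorem _root_.Literature.Computability.Cryptography.sdUnif_congr {ι : Type*} {S : Finset ι} {F G : ι → List Bool}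
    (h : ∀ x ∈ S, F x = G x) (ℓ : ℕ) : sdUnif S F ℓ = sdUnif S G ℓ := by
  classical
  have himg : S.image F = S.image G := Finset.image_congr h
  have hfib : ∀ v, fiber S F v = fiber S G v := fun v => Finset.filter_congr fun x hx => by rw [h x hx]
  unfold sdUnif sdSupport imgProb
  rw [himg]
  exact congrArg _ (Finset.sum_congr rfl fun v _ => by rw [hfib])

/-- A dense level is nonempty. [folklore] -/
theorem _root_.Literature.Computability.Cryptography.nonempty_of_dense {S : ∀ n : ℕ, Finset (List.Vector Bool n)} {n : ℕ}
    (hd : 2 ^ n ≤ n * (S n).card) : (S n).Nonempty := by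
  refine Finset.card_pos.1 (Nat.pos_of_ne_zero fun h0 => ?_)
  rw [h0, Nat.mul_zero] at hd
  exact absurd hd (not_le.2 (Nat.two_pow_pos n))

/-- **Density for `GG` with any pass-through suffix length `t(n)`**: for all large `n`,
`Δ(GG n (r n) (x ‖ τ'), U_{m+t+L}) ≤ 3/n^{α'/2}` (`x ← S_n`, `τ' ← U_{m(n)+t(n)}`), under
`|f x| ≤ P(|x|)`, fibres `≤ 2^{r(n)}` on `S_n` and `2ⁿ ≤ n·|S_n|`. [Y. Liu, R. Pass, FOCS 2020,
Lemma 5.3 (density); arXiv:2009.11514, Appendix] [folklore] -/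
theorem eventually_density_GG (S : ∀ n : ℕ, Finset (List.Vector Bool n)) (r t : ℕ → ℕ)
    (hP : ∀ x : List Bool, (Q.f x).length ≤ Q.P.eval x.length)
    (hreg : ∀ (n : ℕ) (x : List.Vector Bool n), x ∈ S n → preimCard Q.f n x.toList ≤ 2 ^ r n)
    (hdense : ∀ n, 1 ≤ n → 2 ^ n ≤ n * (S n).card) :
    ∀ᶠ n in atTop, ((condUniform (blockSeeds S (Q.m n + t n) n)).map (Q.GG n (r n))).tvDist
        (uniformBits (Q.m n + t n + Q.L n)) ≤ 3 / (n : ℝ) ^ ((Q.α' : ℝ) / 2) := by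
  filter_upwards [eventually_ge_atTop 4, Q.eventually_fit, Q.eventually_slack] with n hn4 hfit hslack
  have hd := hdense n (by omega)
  have hSn : (S n).Nonempty := nonempty_of_dense hd
  have hseeds : (blockSeeds S (Q.m n + t n) n).Nonempty := blockSeeds_nonempty_iff.2 hSn
  have hlenGG : ∀ w ∈ blockSeeds S (Q.m n + t n) n, (Q.GG n (r n) w).length = Q.m n + t n + Q.L n := fun w hw => by
    have hl := length_of_mem_blockSeeds hw
    rw [Q.length_GG (by rw [hl]; omega), hl]; omega
  rw [tvDist_condUniform_map_eq_sdUnif hseeds, sdUnif_eq_distUnif _ _ hlenGG]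
  exact distUnif_GG_le_three S (t n) hn4 hfit hslack hd hP (fun x hx => hreg n x hx)

/-- **Density (Liu–Pass Lemma 5.3, first clause), for the construction `L53Params.F`.** If
`|f x| ≤ P(|x|)`, the fibres of `f` at the points of `S_n` have size `≤ 2^{r(n)}` and
`2ⁿ ≤ n·|S_n|`, then for all large `n` the distribution `f'_{r(n)}(x ‖ τ)` (`x ← S_n`,
`τ ← U_{3n^c}`) is `3/n^{α'/2}`-close to `U_{lpLen53 c α' n}` — in the exact form of the named fact
`liuPass_lemma53`. [Y. Liu, R. Pass, FOCS 2020, Lemma 5.3 (density); arXiv:2009.11514, Appendix]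
[cite: LiuPassFOCS2020, Lemma 5.3 (density; proof in Appendix)] -/
theorem eventually_density (S : ∀ n : ℕ, Finset (List.Vector Bool n)) (r : ℕ → ℕ)
    (hP : ∀ x : List Bool, (Q.f x).length ≤ Q.P.eval x.length)
    (hreg : ∀ (n : ℕ) (x : List.Vector Bool n), x ∈ S n → preimCard Q.f n x.toList ≤ 2 ^ r n)
    (hdense : ∀ n, 1 ≤ n → 2 ^ n ≤ n * (S n).card) :
    ∀ᶠ n in atTop, ((condUniform (lpSeeds S Q.c n)).map (Q.F (r n))).tvDist (uniformBits (lpLen53 Q.c Q.α' n)) ≤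
      3 / (n : ℝ) ^ ((Q.α' : ℝ) / 2) := by
  filter_upwards [eventually_ge_atTop (max Q.γ' 1), Q.eventually_slack,
    Q.eventually_density_GG S r (fun n => Q.kk n * n) hP hreg hdense] with n hn hslack hGG
  have hγ : Q.γ' ≤ n := le_trans (le_max_left _ _) hn
  have hmk := m_add_kk hγ
  have hseedsEq : lpSeeds S Q.c n = blockSeeds S (Q.m n + Q.kk n * n) n := by
    rw [hmk]; rfl
  have hSn : (S n).Nonempty := nonempty_of_dense (hdense n (le_trans (le_max_right _ _) hn))
  have hseeds : (lpSeeds S Q.c n).Nonempty := by rw [hseedsEq]; exact blockSeeds_nonempty_iff.2 hSn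
  have hFG : ∀ w ∈ lpSeeds S Q.c n, Q.F (r n) w = Q.GG n (r n) w := fun w hw => by
    rw [F_eq_GG, Q.length_of_mem_lpSeeds' hw, Q.nOf_eq]
  rw [tvDist_condUniform_map_eq_sdUnif hseeds, sdUnif_congr hFG, ← tvDist_condUniform_map_eq_sdUnif hseeds, hseedsEq,
    Q.lpLen53_eq hslack, ← hmk]
  simpa only [Nat.add_right_comm] using hGG

/-- **Density of the ideal Goldreich–Levin sample** `g(x ‖ ρ) ‖ σ ‖ u` (`|u| = γ'⌊log₂ n⌋`): for all
large `n` it is `3/n^{α'/2}`-close to `U_{ℓ(n) + γ'⌊log₂ n⌋}` (same proof, suffix `σ ‖ u`). This is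
the statistical half of the pseudorandomness clause of Lemma 5.3. [Y. Liu, R. Pass, FOCS 2020,
Appendix ("`HYB₂` is statistically close to uniform")] [folklore] -/
theorem eventually_density_ideal (S : ∀ n : ℕ, Finset (List.Vector Bool n)) (r : ℕ → ℕ)
    (hP : ∀ x : List Bool, (Q.f x).length ≤ Q.P.eval x.length)
    (hreg : ∀ (n : ℕ) (x : List.Vector Bool n), x ∈ S n → preimCard Q.f n x.toList ≤ 2 ^ r n)
    (hdense : ∀ n, 1 ≤ n → 2 ^ n ≤ n * (S n).card) :
    ∀ᶠ n in atTop, (glIdealEns (Q.g r) S Q.m Q.γ' n).tvDist (uniformBits (lpLen53 Q.c Q.α' n + Q.γ' * Nat.log 2 n)) ≤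
      3 / (n : ℝ) ^ ((Q.α' : ℝ) / 2) := by
  filter_upwards [eventually_ge_atTop (max Q.γ' 1), Q.eventually_slack,
    Q.eventually_density_GG S r (fun n => Q.kk n * n + Q.kk n) hP hreg hdense] with n hn hslack hGG
  have hγ : Q.γ' ≤ n := le_trans (le_max_left _ _) hn
  have hmk := m_add_kk hγ
  have hSn : (S n).Nonempty := nonempty_of_dense (hdense n (le_trans (le_max_right _ _) hn))
  have hseeds : (blockSeeds S (Q.m n + (Q.kk n * n + Q.kk n)) n).Nonempty := blockSeeds_nonempty_iff.2 hSn
  have hE : glIdealEns (Q.g r) S Q.m Q.γ' n =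
      (condUniform (blockSeeds S (Q.m n + (Q.kk n * n + Q.kk n)) n)).map (glIdeal (Q.g r) (Q.m n) n) := by
    simp only [glIdealEns, kk, Nat.add_assoc]
  have hIG : ∀ w ∈ blockSeeds S (Q.m n + (Q.kk n * n + Q.kk n)) n, glIdeal (Q.g r) (Q.m n) n w = Q.GG n (r n) w :=
    fun w hw => Q.glIdeal_eq_GG hγ (by rw [length_of_mem_blockSeeds hw]; omega)
  have hlen : lpLen53 Q.c Q.α' n + Q.γ' * Nat.log 2 n = Q.m n + (Q.kk n * n + Q.kk n) + Q.L n := by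
    rw [Q.lpLen53_eq hslack, ← hmk]; unfold kk; ring
  rw [hE, tvDist_condUniform_map_eq_sdUnif hseeds, sdUnif_congr hIG, ← tvDist_condUniform_map_eq_sdUnif hseeds, hlen]
  exact hGG

end L53Params

end Literature.Computability.Cryptography
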